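import Literature.Geometry.GeometricMeasureTheory.Currents
import Mathlib.Analysis.Calculus.TangentCone.Seq
import Mathlib.Analysis.Normed.Module.Ball.Pointwise
import Mathlib.Topology.Algebra.Order.Field
import HarnessLib

/-!
# Dilation invariance: `𝓗^m`, upper densities, approximate tangent cones and rectifiability
# under `y ↦ b + r • y`

The affine dilations `A_{b,r} : y ↦ b + r • y` (`r > 0`) of a real normed space `V` — the maps
`τ_b ∘ μ_r` whose inverses `μ_{1/r} ∘ τ_{-b}` produce the blow-ups `(μ_{1/r} ∘ τ_{-b})_# T` of a
current at `b` [Federer1969, 4.3.16] — act on the objects of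
`Literature.Geometry.GeometricMeasureTheory.Currents` as follows (all proved here, from Mathlib):

* `euclideanHausdorffMeasure_image_add_smul`, `euclideanHausdorffMeasure_preimage_add_smul` —
  `𝓗^m(A(E)) = rᵐ 𝓗^m(E)`, `𝓗^m(A⁻¹(E)) = r⁻ᵐ 𝓗^m(E)` (Mathlib's homothety and translation
  invariance of `μHE`), and `map_add_smul_restrict_preimage` — the push-forward
  `A_# (𝓗^m ⌞ A⁻¹ E) = r⁻ᵐ · 𝓗^m ⌞ E`;
* `posTangentConeAt_image_add_smul` — `Tan(A(S), A(x)) = Tan(S, x)` (Federer's tangent cone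
  3.1.21 = Mathlib's `posTangentConeAt`; a cone, so the factor `r` is absorbed);
* `upperDensity_eq_of_closedBall_image` and `approxTangentCone_eq_of_image_add_smul` —
  `Θ^{*m}(ν, x) = Θ^{*m}(μ, A x)` and `Tan^m(ν, x) = Tan^m(μ, A x)` whenever
  `μ(A(E)) = rᵐ ν(E)` for all `E` [Federer1969, 2.10.19, 3.2.16]; in particular
  `approxTangentCone_restrict_preimage_add_smul`:
  `Tan^m(𝓗^m ⌞ A⁻¹W, x) = Tan^m(𝓗^m ⌞ W, A x)` for measurable `W`;
* `approxTangentCone_restrict_inter_eq_of_isOpen` — locality: `Tan^m(μ ⌞ (W ∩ U), x) = Tan^m(μ ⌞ W, x)`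
  for `U` open, `x ∈ U`;
* `IsCountablyRectifiable.preimage_add_smul` — `A⁻¹(W)` is countably `m`-rectifiable when `W` is;
* `locallyIntegrableOn_comp_add_smul` — `η ∘ A` is locally `𝓗^m ⌞ A⁻¹W`-integrable on any
  `Ω'` with `A(Ω') ⊆ Ω` when `η` is locally `𝓗^m ⌞ W`-integrable on `Ω`.

These are the bricks showing that blow-ups of (locally) rectifiable currents are (locally)
rectifiable with the transported data (used for holomorphic chains in
`Literature/Geometry/Kaehler/HolomorphicChainFactsProofs.lean`).

## References

* H. Federer, *Geometric Measure Theory*, Springer 1969, 2.10.19, 3.1.21, 3.2.14, 3.2.16, 4.3.16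
  [Federer1969].
-/

open scoped ENNReal NNReal Topology Pointwise
open MeasureTheory MeasureTheory.Measure TopologicalSpace Set Filter Metric

namespace Literature.Geometry.GeometricMeasureTheory

variable {V : Type*} [NormedAddCommGroup V] [NormedSpace ℝ V]

/-! ### The affine dilations `y ↦ b + r • y` -/

section Affine

/-- `A_{b,r}` is a bijection for `r ≠ 0`, with inverse `z ↦ -(r⁻¹ • b) + r⁻¹ • z`. [folklore] -/
theorem bijective_add_smul (b : V) {r : ℝ} (hr : r ≠ 0) :
    Function.Bijective (fun y : V => b + r • y) := by
  refine ⟨fun y y' h => ?_, fun z => ⟨-(r⁻¹ • b) + r⁻¹ • z, ?_⟩⟩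
  · have h' : r • y = r • y' := add_left_cancel h
    exact smul_right_injective V hr h'
  · simp only [smul_add, smul_neg, smul_smul, mul_inv_cancel₀ hr, one_smul]
    abel

/-- Preimages under `A_{b,r}` are images under the inverse dilation `A_{-b/r, 1/r}`. [folklore] -/
theorem preimage_add_smul_eq_image (b : V) {r : ℝ} (hr : r ≠ 0) (E : Set V) :
    (fun y : V => b + r • y) ⁻¹' E = (fun z : V => -(r⁻¹ • b) + r⁻¹ • z) '' E := by
  ext y
  constructor
  · intro hy
    refine ⟨b + r • y, hy, ?_⟩
    simp only [smul_add, smul_smul, inv_mul_cancel₀ hr, one_smul]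
    abel
  · rintro ⟨z, hz, rfl⟩
    simp only [mem_preimage, smul_add, smul_neg, smul_smul, mul_inv_cancel₀ hr, one_smul]
    convert hz using 1
    abel

/-- `A_{b,r}` maps closed balls to closed balls: `A(𝐁(x,ρ)) = 𝐁(A x, rρ)` (`r > 0`). [folklore] -/
theorem image_add_smul_closedBall (b x : V) {r : ℝ} (hr : 0 < r) (ρ : ℝ) :
    (fun y : V => b + r • y) '' closedBall x ρ = closedBall (b + r • x) (r * ρ) := by
  have e : (fun y : V => b + r • y) = (fun w : V => b +ᵥ w) ∘ fun y : V => r • y := rfl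
  rw [e, Set.image_comp, Set.image_smul, smul_closedBall' hr.ne', Set.image_vadd, Metric.vadd_closedBall,
    Real.norm_of_nonneg hr.le, vadd_eq_add]

end Affine

/-! ### Positive tangent cones -/

section TangentCone

/-- **`Tan(A(S), A(x)) = Tan(S, x)`** for the affine dilation `A y = b + r • y`, `r > 0`: the
tangent cone (Federer 3.1.21, Mathlib's `posTangentConeAt`) is translation invariant and a cone.
[cite: Federer1969, 3.1.21] -/
theorem posTangentConeAt_image_add_smul (b x : V) {r : ℝ} (hr : 0 < r) (s : Set V) :
    posTangentConeAt ((fun y : V => b + r • y) '' s) (b + r • x) = posTangentConeAt s x := by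
  ext v
  rw [mem_tangentConeAt_iff_exists_seq, mem_tangentConeAt_iff_exists_seq]
  constructor
  · rintro ⟨c, d, hd0, hds, hcd⟩
    refine ⟨fun n => c n * r.toNNReal, fun n => r⁻¹ • d n, ?_, ?_, ?_⟩
    · simpa using hd0.const_smul r⁻¹
    · filter_upwards [hds] with n hn
      obtain ⟨w, hw, hwe⟩ := hn
      have h1 : r • w = r • x + d n := by
        rw [add_assoc] at hwe
        exact add_left_cancel hwe
      have h2 : w = x + r⁻¹ • d n := by
        calc w = r⁻¹ • (r • w) := by rw [smul_smul, inv_mul_cancel₀ hr.ne', one_smul]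
          _ = x + r⁻¹ • d n := by rw [h1, smul_add, smul_smul, inv_mul_cancel₀ hr.ne', one_smul]
      rw [← h2]
      exact hw
    · have e : (fun n => (c n * r.toNNReal : ℝ≥0) • (r⁻¹ • d n)) = fun n => c n • d n := by
        funext n
        rw [NNReal.smul_def, NNReal.coe_mul, Real.coe_toNNReal _ hr.le, smul_smul, mul_assoc,
          mul_inv_cancel₀ hr.ne', mul_one, ← NNReal.smul_def]
      rw [e]
      exact hcd
  · rintro ⟨c, d, hd0, hds, hcd⟩
    refine ⟨fun n => c n * r⁻¹.toNNReal, fun n => r • d n, ?_, ?_, ?_⟩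
    · simpa using hd0.const_smul r
    · filter_upwards [hds] with n hn
      exact ⟨x + d n, hn, by simp only [smul_add, add_assoc]⟩
    · have e : (fun n => (c n * r⁻¹.toNNReal : ℝ≥0) • (r • d n)) = fun n => c n • d n := by
        funext n
        rw [NNReal.smul_def, NNReal.coe_mul, Real.coe_toNNReal _ (inv_nonneg.2 hr.le), smul_smul,
          mul_assoc, inv_mul_cancel₀ hr.ne', mul_one, ← NNReal.smul_def]
      rw [e]
      exact hcd

end TangentCone

/-! ### Upper densities and approximate tangent cones -/

section Density

variable [MeasurableSpace V] {m : ℕ}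

/-- **`Θ^{*m}(ν, x) = Θ^{*m}(μ, A x)`** when `μ(𝐁(A x, rρ)) = rᵐ ν(𝐁(x, ρ))` for all `ρ > 0`
(`A y = b + r • y`, `r > 0`): the density ratios of `ν` at radius `ρ` and of `μ` at radius `rρ`
coincide, and `ρ ↦ rρ` preserves `𝓝[>] 0`. [cite: Federer1969, 2.10.19] -/
theorem upperDensity_eq_of_closedBall_image (μ ν : Measure V) (b x : V) {r : ℝ} (hr : 0 < r)
    (h : ∀ ρ : ℝ, 0 < ρ →
      μ (closedBall (b + r • x) (r * ρ)) = ENNReal.ofReal (r ^ m) * ν (closedBall x ρ)) :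
    upperDensity m ν x = upperDensity m μ (b + r • x) := by
  unfold upperDensity
  have hc0 : ENNReal.ofReal (r ^ m) ≠ 0 := (ENNReal.ofReal_pos.2 (pow_pos hr m)).ne'
  have hfg : ∀ᶠ ρ in 𝓝[>] (0 : ℝ),
      ν (closedBall x ρ) / (unitBallVolume m * ENNReal.ofReal (ρ ^ m)) =
        ((fun ρ' : ℝ => μ (closedBall (b + r • x) ρ') / (unitBallVolume m * ENNReal.ofReal (ρ' ^ m)))
          ∘ fun ρ => r * ρ) ρ := by
    filter_upwards [self_mem_nhdsWithin] with ρ hρ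
    simp only [Function.comp_apply]
    rw [h ρ hρ, mul_pow, ENNReal.ofReal_mul (pow_nonneg hr.le _),
      mul_left_comm (unitBallVolume m), ENNReal.mul_div_mul_left _ _ hc0 ENNReal.ofReal_ne_top]
  rw [limsup_congr hfg, limsup_comp]
  congr 1
  have hinv : (fun ρ : ℝ => r * ρ) ∘ (fun ρ : ℝ => r⁻¹ * ρ) = id := by
    funext ρ; simp [← mul_assoc, mul_inv_cancel₀ hr.ne']
  have hinv' : (fun ρ : ℝ => r⁻¹ * ρ) ∘ (fun ρ : ℝ => r * ρ) = id := by
    funext ρ; simp [← mul_assoc, inv_mul_cancel₀ hr.ne']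
  rw [Filter.map_eq_comap_of_inverse hinv hinv']
  exact comap_mulLeft_nhdsGT_zero (inv_pos.2 hr)

/-- **`Tan^m(ν, x) = Tan^m(μ, A x)`** for `A y = b + r • y`, `r > 0`, whenever `μ(A(E)) = rᵐ ν(E)`
for every set `E` (e.g. `μ = 𝓗^m ⌞ W`, `ν = 𝓗^m ⌞ A⁻¹W`): both the defining densities
`Θ^{*m}(· ⌞ Sᶜ)` and the tangent cones `Tan(S, ·)` correspond under `S ↦ A(S)`.
[cite: Federer1969, 3.2.16] -/
theorem approxTangentCone_eq_of_image_add_smul [OpensMeasurableSpace V] (μ ν : Measure V) (b x : V)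
    {r : ℝ} (hr : 0 < r)
    (h : ∀ E : Set V, μ ((fun y : V => b + r • y) '' E) = ENNReal.ofReal (r ^ m) * ν E) :
    approxTangentCone m ν x = approxTangentCone m μ (b + r • x) := by
  have hA := bijective_add_smul b hr.ne'
  -- densities of the restricted measures correspond under `S ↦ A(S)`
  have key : ∀ S : Set V, upperDensity m (ν.restrict ((fun y : V => b + r • y) ⁻¹' S)ᶜ) x =
      upperDensity m (μ.restrict Sᶜ) (b + r • x) := by
    intro S
    refine upperDensity_eq_of_closedBall_image _ _ b x hr fun ρ _ => ?_
    rw [Measure.restrict_apply measurableSet_closedBall,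
      Measure.restrict_apply measurableSet_closedBall, ← image_add_smul_closedBall b x hr ρ, ← h,
      Set.image_inter hA.injective, ← Set.preimage_compl, Set.image_preimage_eq _ hA.surjective]
  ext v
  simp only [approxTangentCone, mem_iInter]
  constructor
  · intro hv S hS
    rw [← Set.image_preimage_eq S hA.surjective, posTangentConeAt_image_add_smul b x hr]
    exact hv _ (by rwa [key])
  · intro hv S hS
    rw [← posTangentConeAt_image_add_smul b x hr S]
    refine hv _ ?_
    rwa [← key, Set.preimage_image_eq _ hA.injective]

/-- **Locality of approximate tangent cones**: `Tan^m(μ ⌞ (W ∩ U), x) = Tan^m(μ ⌞ W, x)` for `W`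
measurable and `U` open containing `x` (upper densities only see small balls).
[cite: Federer1969, 3.2.16] -/
theorem approxTangentCone_restrict_inter_eq_of_isOpen [OpensMeasurableSpace V] (μ : Measure V)
    {W U : Set V} (hW : MeasurableSet W) {x : V} (hU : IsOpen U) (hx : x ∈ U) :
    approxTangentCone m (μ.restrict (W ∩ U)) x = approxTangentCone m (μ.restrict W) x := by
  obtain ⟨ε, hε, hball⟩ := Metric.isOpen_iff.1 hU x hx
  have key : ∀ S : Set V, upperDensity m ((μ.restrict (W ∩ U)).restrict Sᶜ) x =
      upperDensity m ((μ.restrict W).restrict Sᶜ) x := by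
    intro S
    unfold upperDensity
    refine limsup_congr ?_
    filter_upwards [Ioo_mem_nhdsGT hε] with ρ hρ
    have hsub : closedBall x ρ ⊆ U := (closedBall_subset_ball hρ.2).trans hball
    have hset : closedBall x ρ ∩ Sᶜ ∩ (W ∩ U) = closedBall x ρ ∩ Sᶜ ∩ W := by
      rw [← inter_assoc]
      exact inter_eq_left.2 fun z hz => hsub hz.1.1
    rw [Measure.restrict_apply measurableSet_closedBall,
      Measure.restrict_apply measurableSet_closedBall,
      Measure.restrict_apply' (hW.inter hU.measurableSet), Measure.restrict_apply' hW, hset]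
  ext v
  simp only [approxTangentCone, mem_iInter, key]

end Density

/-! ### Hausdorff measure `μHE[m]` under `y ↦ b + r • y` -/

section Hausdorff

variable [MeasurableSpace V] [BorelSpace V] {m : ℕ}

/-- **`𝓗^m(A(E)) = rᵐ · 𝓗^m(E)`** for `A y = b + r • y`, `r > 0` (translation invariance and
homogeneity of the Euclidean-normalised Hausdorff measure). [cite: Federer1969, 2.10.2] -/
theorem euclideanHausdorffMeasure_image_add_smul (b : V) {r : ℝ} (hr : 0 < r) (E : Set V) :
    (μHE[m] : Measure V) ((fun y : V => b + r • y) '' E) =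
      ENNReal.ofReal (r ^ m) * (μHE[m] : Measure V) E := by
  have e : (fun y : V => b + r • y) = (fun w : V => b +ᵥ w) ∘ fun y : V => r • y := rfl
  rw [e, Set.image_comp, Set.image_smul, Set.image_vadd, measure_vadd,
    euclideanHausdorffMeasure_smul₀ m hr.ne' E, ENNReal.smul_def, smul_eq_mul, ENNReal.coe_pow,
    ENNReal.ofReal_pow hr.le, Real.nnnorm_of_nonneg hr.le, ENNReal.ofReal_eq_coe_nnreal hr.le]

/-- **`𝓗^m(A⁻¹(E)) = r⁻ᵐ · 𝓗^m(E)`** for `A y = b + r • y`, `r > 0`. [cite: Federer1969, 2.10.2] -/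
theorem euclideanHausdorffMeasure_preimage_add_smul (b : V) {r : ℝ} (hr : 0 < r) (E : Set V) :
    (μHE[m] : Measure V) ((fun y : V => b + r • y) ⁻¹' E) =
      ENNReal.ofReal (r⁻¹ ^ m) * (μHE[m] : Measure V) E := by
  rw [preimage_add_smul_eq_image b hr.ne' E]
  exact euclideanHausdorffMeasure_image_add_smul _ (inv_pos.2 hr) E

/-- The scaling relation `(𝓗^m ⌞ W)(A(E)) = rᵐ · (𝓗^m ⌞ A⁻¹W)(E)` between `𝓗^m ⌞ W` and
`𝓗^m ⌞ A⁻¹(W)` (`W` measurable), the hypothesis of `approxTangentCone_eq_of_image_add_smul`.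
[cite: Federer1969, 2.10.2] -/
theorem euclideanHausdorffMeasure_restrict_image_add_smul {W : Set V} (hW : MeasurableSet W)
    (b : V) {r : ℝ} (hr : 0 < r) (E : Set V) :
    ((μHE[m] : Measure V).restrict W) ((fun y : V => b + r • y) '' E) =
      ENNReal.ofReal (r ^ m) *
        ((μHE[m] : Measure V).restrict ((fun y : V => b + r • y) ⁻¹' W)) E := by
  have hmeas : Measurable (fun y : V => b + r • y) := (measurable_const_smul r).const_add b
  rw [Measure.restrict_apply' hW, Measure.restrict_apply' (hW.preimage hmeas),
    ← Set.image_inter_preimage, euclideanHausdorffMeasure_image_add_smul b hr]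

/-- **`Tan^m(𝓗^m ⌞ A⁻¹W, x) = Tan^m(𝓗^m ⌞ W, A x)`** for `A y = b + r • y`, `r > 0`, `W`
measurable: approximate tangent cones of the blown-up data are those of the original data at the
corresponding points. [cite: Federer1969, 3.2.16] -/
theorem approxTangentCone_restrict_preimage_add_smul {W : Set V} (hW : MeasurableSet W) (b x : V)
    {r : ℝ} (hr : 0 < r) :
    approxTangentCone m ((μHE[m] : Measure V).restrict ((fun y : V => b + r • y) ⁻¹' W)) x =
      approxTangentCone m ((μHE[m] : Measure V).restrict W) (b + r • x) :=
  approxTangentCone_eq_of_image_add_smul _ _ b x hr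
    (euclideanHausdorffMeasure_restrict_image_add_smul hW b hr)

/-- **The push-forward `A_#(𝓗^m ⌞ A⁻¹E) = r⁻ᵐ · 𝓗^m ⌞ E`** (`A y = b + r • y`, `r > 0`, any
`E`): the change of variables behind `(μ_{1/r} ∘ τ_{-b})_#` of a current of integration.
[cite: Federer1969, 4.3.16] -/
theorem map_add_smul_restrict_preimage (b : V) {r : ℝ} (hr : 0 < r) (E : Set V) :
    Measure.map (fun y : V => b + r • y)
        ((μHE[m] : Measure V).restrict ((fun y : V => b + r • y) ⁻¹' E)) =
      ENNReal.ofReal (r⁻¹ ^ m) • (μHE[m] : Measure V).restrict E := by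
  have hmeas : Measurable (fun y : V => b + r • y) := (measurable_const_smul r).const_add b
  ext t ht
  rw [Measure.map_apply hmeas ht, Measure.restrict_apply (ht.preimage hmeas), ← Set.preimage_inter,
    euclideanHausdorffMeasure_preimage_add_smul b hr, Measure.smul_apply, smul_eq_mul,
    Measure.restrict_apply ht]

/-- **Countable rectifiability is invariant under `A y = b + r • y`** (`r > 0`): the Lipschitz
parametrisations `fᵢ` of `W` give the Lipschitz parametrisations `A⁻¹ ∘ fᵢ` of `A⁻¹(W)`, and
`𝓗^m`-null sets pull back to `𝓗^m`-null sets. [cite: Federer1969, 3.2.14] -/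
theorem IsCountablyRectifiable.preimage_add_smul {W : Set V} (hW : IsCountablyRectifiable m W)
    (b : V) {r : ℝ} (hr : 0 < r) :
    IsCountablyRectifiable m ((fun y : V => b + r • y) ⁻¹' W) := by
  obtain ⟨f, hf, h0⟩ := hW
  refine ⟨fun i z => -(r⁻¹ • b) + r⁻¹ • f i z, fun i => ?_, ?_⟩
  · obtain ⟨K, hK⟩ := hf i
    have h1 : LipschitzWith ‖r⁻¹‖₊ (fun w : V => r⁻¹ • w) := lipschitzWith_smul r⁻¹
    exact ⟨0 + ‖r⁻¹‖₊ * K, (LipschitzWith.const (-(r⁻¹ • b))).add (h1.comp hK)⟩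
  · have hrange : ∀ i, range (fun z => -(r⁻¹ • b) + r⁻¹ • f i z) =
        (fun y : V => b + r • y) ⁻¹' range (f i) := by
      intro i
      rw [preimage_add_smul_eq_image b hr.ne', ← Set.range_comp]
      rfl
    have hset : (fun y : V => b + r • y) ⁻¹' W \ ⋃ i, range (fun z => -(r⁻¹ • b) + r⁻¹ • f i z) =
        (fun y : V => b + r • y) ⁻¹' (W \ ⋃ i, range (f i)) := by
      simp only [hrange, Set.preimage_sdiff, Set.preimage_iUnion]
    rw [hset, euclideanHausdorffMeasure_preimage_add_smul b hr, h0, mul_zero]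

/-- **Local integrability is transported by `A y = b + r • y`** (`r > 0`): if `η` is locally
`𝓗^m ⌞ W`-integrable on `Ω` and `A(Ω') ⊆ Ω`, then `η ∘ A` is locally
`𝓗^m ⌞ A⁻¹W`-integrable on `Ω'` — by the push-forward formula `A_#(𝓗^m ⌞ A⁻¹E) = r⁻ᵐ 𝓗^m ⌞ E`.
This carries the local summability of rectifiable data over to the blown-up data.
[cite: Federer1969, 4.3.16] -/
theorem locallyIntegrableOn_comp_add_smul {F : Type*} [NormedAddCommGroup F] {η : V → F}
    {Ω Ω' W : Set V} (hW : MeasurableSet W) (b : V) {r : ℝ} (hr : 0 < r)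
    (hA : (fun y : V => b + r • y) '' Ω' ⊆ Ω)
    (hη : LocallyIntegrableOn η Ω ((μHE[m] : Measure V).restrict W)) :
    LocallyIntegrableOn (fun y => η (b + r • y)) Ω'
      ((μHE[m] : Measure V).restrict ((fun y : V => b + r • y) ⁻¹' W)) := by
  have hmeas : Measurable (fun y : V => b + r • y) := (measurable_const_smul r).const_add b
  have hcont : Continuous (fun y : V => b + r • y) := continuous_const.add (continuous_const_smul r)
  let eA : V ≃ᵐ V :=
    ((Homeomorph.smulOfNeZero r hr.ne').trans (Homeomorph.addLeft b)).toMeasurableEquiv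
  have heA : ⇑eA = fun y : V => b + r • y := rfl
  intro y hy
  obtain ⟨u, hu, hint⟩ := hη (b + r • y) (hA ⟨y, hy, rfl⟩)
  obtain ⟨u₀, hu₀o, hyu₀, hu₀⟩ := mem_nhdsWithin.1 hu
  refine ⟨(fun y : V => b + r • y) ⁻¹' u₀ ∩ Ω', inter_mem
    (mem_nhdsWithin_of_mem_nhds ((hu₀o.preimage hcont).mem_nhds hyu₀)) self_mem_nhdsWithin, ?_⟩
  have hsub : (fun y : V => b + r • y) ⁻¹' u₀ ∩ Ω' ⊆ (fun y : V => b + r • y) ⁻¹' u := by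
    rintro z ⟨hz1, hz2⟩
    exact hu₀ ⟨hz1, hA ⟨z, hz2, rfl⟩⟩
  refine IntegrableOn.mono_set ?_ hsub
  rw [IntegrableOn, Measure.restrict_restrict' (hW.preimage hmeas), ← Set.preimage_inter]
  have hint' : Integrable η ((μHE[m] : Measure V).restrict (u ∩ W)) := by
    rw [← Measure.restrict_restrict' hW]
    exact hint
  have hmap := map_add_smul_restrict_preimage (m := m) b hr (u ∩ W)
  have key : Integrable η (Measure.map eA
      ((μHE[m] : Measure V).restrict ((fun y : V => b + r • y) ⁻¹' (u ∩ W)))) := by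
    rw [heA, hmap]
    exact hint'.smul_measure ENNReal.ofReal_ne_top
  exact (integrable_map_equiv eA η).1 key

end Hausdorff


end Literature.Geometry.GeometricMeasureTheory
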